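import Summits.QuantumAdvantage.QuantumAdvantage.Theorems.SosSandwichTransferPBEventOSMFinal
import Literature.Computability.QuantumComplexity.ForrelationLemma24Mem
import Literature.Computability.Cryptography.ClassBQPReductionProofs
import HarnessLib

/-!
# Crux `TransferPB` (stmt-QuantumAdvantage-15238, route SosSandwich), line `birth` — the last stub from ONE Karp reduction

With the machine half done (`EvOSM.stub_pbOracleSimulation_of_Q`, `Theorems/SosSandwichTransferPBEventOSMFinal.lean`:
the registered stub `stub_pbOracleSimulation` follows from (Q) `∀ c k F uniform r, nodeProblem F r c k ∈ PromiseBQP`),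
the tree's quantum side already holds the target of the natural reduction: QSIM (`qSimProblem`: decide
`⟨0ⁿ|Q|0ⁿ⟩ ≥ 3/5` vs `|⟨0ⁿ|Q|0ⁿ⟩| ≤ 1/100` for an `{H, CCSIGN}` circuit `Q`) is in `PromiseBQP`
(`AaronsonAmbainis2018_lemma24_mem_holds`, `Literature/Computability/QuantumComplexity/ForrelationLemma24Mem.lean`) and
`PromiseBQP` is closed downwards under Karp reductions of promise problems (`mem_PromiseBQP_of_polyTimeReducible`,
`Literature/Computability/Cryptography/ClassBQPReductionProofs.lean`). Hence

* **`stub_pbOracleSimulation_of_karp`** — the registered stub `Sig.stub_pbOracleSimulation` follows from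
  (K) `∀ c k F uniform r, (nodeProblem F r c k).PolyTimeReducible qSimProblem`: ONE polynomial-time many-one
  reduction mapping a BLOCK / SINGLE / MEAN instance `⟨x, ρ, ·⟩` of the node-test problem
  (`Theorems/SosSandwichTransferPBMachineDefs.lean`) to an oracle-free `{H, CCSIGN}` circuit whose return amplitude
  separates the gapped magnitude / mean test (the hard-wired restriction `ρ` and a `2T`-wise independent hash in place
  of the random completion `y`, amplitude estimation, gap amplification `w/2`-vs-`w` ↦ `1/100`-vs-`3/5`).

All proved here; (K) is a plain `Prop` argument (no named fact). Sources: S. Aaronson, A. Ambainis, Theory Comput.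
10 (2014), proof of Thm. 23 (p. 14); S. Aaronson, A. Ambainis, SIAM J. Comput. 47 (2018), §6 Lemma 24;
O. Goldreich, On promise problems (2006), §1.2 Def. 3.
-/

-- D-0017: single-conjunct summit ⇒ the duplicate `QuantumAdvantage.QuantumAdvantage` is mandated.
set_option linter.dupNamespace false

noncomputable section

namespace Summit.QuantumAdvantage.QuantumAdvantage.Cruxes.TransferPB.Birth

open Finset Literature.Computability.Cryptography Literature.Computability.Complexity
  Literature.Computability.QuantumComplexity Literature.Computability.QuantumComplexity.ClassicalSimulation
open Summit.QuantumAdvantage.QuantumAdvantage.Theses.SosSandwich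

namespace SimTreePB

/-- **`stub_pbOracleSimulation` from ONE Karp reduction.** If for all `c, k`, uniform `F`, `r` the node-test
promise problem `nodeProblem F r c k` polynomial-time many-one reduces to QSIM, then the registered stub
`Sig.stub_pbOracleSimulation` holds: QSIM is in `PromiseBQP` (`AaronsonAmbainis2018_lemma24_mem_holds`), `PromiseBQP`
is closed downwards under Karp reductions (`mem_PromiseBQP_of_polyTimeReducible`), and the machine half is
`EvOSM.stub_pbOracleSimulation_of_Q`. [cite: AaronsonAmbainis2014, Thm. 23 (proof, p. 14)]
[cite: AaronsonAmbainis2018, §6 Lemma 24] -/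
theorem stub_pbOracleSimulation_of_karp
    (hK : ∀ (c k : ℕ) (F : QCircuitFamily cliffordT), F.IsUniform → ∀ r : Polynomial ℕ,
      (nodeProblem F r c k).PolyTimeReducible qSimProblem) :
    Sig.stub_pbOracleSimulation :=
  EvOSM.stub_pbOracleSimulation_of_Q fun c k F hF r =>
    mem_PromiseBQP_of_polyTimeReducible (hK c k F hF r) AaronsonAmbainis2018_lemma24_mem_holds

end SimTreePB

end Summit.QuantumAdvantage.QuantumAdvantage.Cruxes.TransferPB.Birth

end
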